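import Mathlib
import Summits.Ventures.PercRepro2.LocRows
import Summits.Ventures.PercRepro2.SwRow
import Summits.Ventures.PercRepro2.SwOut
import Summits.Ventures.PercRepro2.SwAllRow
import Summits.Ventures.PercRepro2.SwOutAll
import Summits.Ventures.PercRepro2.SwOutReducible
import Summits.Ventures.PercRepro2.SwOutBlocks
import Summits.Ventures.PercRepro2.SwOutJunctionH1Defs
import Summits.Ventures.PercRepro2.SwOutJunctionH1Key
import Summits.Ventures.PercRepro2.SwOutJunctionH1EdgeDefs
import Summits.Ventures.PercRepro2.SwOutJunctionH1EdgeLift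
import Summits.Ventures.PercRepro2.SwOutJunctionH1EdgeUniform
import Summits.Ventures.PercRepro2.SwOutJunctionH1EdgeHyp

/-!
# THEOREM A WITH THE EDGE `h–u`: the rigid inequality on every (H1) single-junction class whose
junction is adjacent to `h` (blind cell PercRepro2, night-4 g29, 2026-08-28; proofs/NIGHT4-G29.md §4)

g14's Theorem A (`rigidOK_of_junctionH1`) needs the junction `u` NOT adjacent to `h`.  Here `u` is
joined to `h` by ONE edge `e₀` (h-arms and pure components at `u` as in (H1)).  Proof: in the
subdivided graph `G⁺` (`e₀` split at `w`, the outside edge `w–l` added) Theorem A applies verbatim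
(`SwOutJunctionH1EdgeHyp`), its block decomposition is summed over the UNIFORM points only
(`card_le_of_blocks_on`: every block of a uniform point is uniform, `uniform_of_mem_blockOf`), and
the uniform points are the uniform lifts of the `Q`-class of `G`, with the rigid edge sets pushed
along `e₀ ↦ {h–w, w–u}` (`card_red_eq`, `card_blue_eq`): **`rigidOK_of_junctionH1_edge`**; hence
`reducible_of_junctionH1_edge`, `swAll_of_junctionH1_edge`, **`sw_of_junctionH1_edge`** — rows
2′SW-ALL and (SW) on every graph in which every vertex other than `l, h, o` is joined to `l` or is
one vertex `u ∉ N(l)` joined to `h` by a single edge whose other neighbours satisfy (H1).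
-/

namespace Summit.Ventures.PercRepro2

namespace LocRows

open Hull

variable {V : Type*} {E : Type*} [Fintype E] [DecidableEq E]

open scoped Classical

/-! ## The rigid inequality on a block-closed part of a class -/

section BlocksOn

variable {ends : E → Sym2 V} {l h o : V} {U : Set V}

/-- **The rigid inequality on a block-closed part `P` of a class from a block decomposition**: the
two counts over the `P`-points split along the fibres of the key, each fibre is the `Q`-part of a
block of a `P`-point, and `P` is a union of blocks. -/
theorem card_le_of_blocks_on (ξ : Config E) {K : Type*} (key : Config E → K)
    (block : K → Finset (Config E)) (P : Config E → Prop)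
    (hmem : ∀ ζ ∈ swOutSide ends l h o U ξ, ζ ∈ block (key ζ))
    (hblock : ∀ ζ ∈ swOutSide ends l h o U ξ, ∀ ζ' ∈ block (key ζ),
      ζ' ∈ tgtU ends l h {S : Set V | o ∈ S} → ζ' ∈ swOutSide ends l h o U ξ ∧ key ζ' = key ζ)
    (hP : ∀ ζ ∈ swOutSide ends l h o U ξ, P ζ → ∀ ζ' ∈ block (key ζ), P ζ')
    (hineq : ∀ ζ ∈ swOutSide ends l h o U ξ, ∀ 𝓔 : Set (Set E), IsUpperSet 𝓔 →
      ((block (key ζ)).filter fun ζ' =>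
          ζ' ∈ tgtU ends l h {S : Set V | o ∈ S} ∧ redEdges ends ζ' h ∈ 𝓔).card ≤
        ((block (key ζ)).filter fun ζ' =>
          ζ' ∈ tgtU ends l h {S : Set V | o ∈ S} ∧ blueEdges ends ζ' h ∈ 𝓔).card)
    {𝓔 : Set (Set E)} (h𝓔 : IsUpperSet 𝓔) :
    ((swOutSide ends l h o U ξ).filter fun ζ => P ζ ∧ redEdges ends ζ h ∈ 𝓔).card ≤
      ((swOutSide ends l h o U ξ).filter fun ζ => P ζ ∧ blueEdges ends ζ h ∈ 𝓔).card := by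
  let S₀ : Finset K := ((swOutSide ends l h o U ξ).filter fun ζ => P ζ).image key
  have hmapR : ∀ ζ ∈ (swOutSide ends l h o U ξ).filter fun ζ => P ζ ∧ redEdges ends ζ h ∈ 𝓔,
      key ζ ∈ S₀ := fun ζ hζ => Finset.mem_image_of_mem key
        (Finset.mem_filter.2 ⟨(Finset.mem_filter.1 hζ).1, (Finset.mem_filter.1 hζ).2.1⟩)
  have hmapB : ∀ ζ ∈ (swOutSide ends l h o U ξ).filter fun ζ => P ζ ∧ blueEdges ends ζ h ∈ 𝓔,
      key ζ ∈ S₀ := fun ζ hζ => Finset.mem_image_of_mem key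
        (Finset.mem_filter.2 ⟨(Finset.mem_filter.1 hζ).1, (Finset.mem_filter.1 hζ).2.1⟩)
  rw [Finset.card_eq_sum_card_fiberwise hmapR, Finset.card_eq_sum_card_fiberwise hmapB]
  refine Finset.sum_le_sum fun k hk => ?_
  obtain ⟨ζ₀, hζ₀, rfl⟩ := Finset.mem_image.1 hk
  have hζ₀' := Finset.mem_filter.1 hζ₀
  have hfib : ∀ Q' : Config E → Prop,
      ((swOutSide ends l h o U ξ).filter fun ζ => P ζ ∧ Q' ζ).filter (fun ζ => key ζ = key ζ₀) =
        (block (key ζ₀)).filter fun ζ' => ζ' ∈ tgtU ends l h {S : Set V | o ∈ S} ∧ Q' ζ' := by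
    intro Q'
    ext ζ'
    simp only [Finset.mem_filter]
    constructor
    · rintro ⟨⟨hζ', _, hQ'⟩, hkey⟩
      have := hmem ζ' hζ'
      rw [hkey] at this
      exact ⟨this, (mem_swOutSide.1 hζ').1, hQ'⟩
    · rintro ⟨hb, hQ, hQ'⟩
      obtain ⟨hcl, hkey⟩ := hblock ζ₀ hζ₀'.1 ζ' hb hQ
      exact ⟨⟨hcl, hP ζ₀ hζ₀'.1 hζ₀'.2 ζ' hb, hQ'⟩, hkey⟩
  rw [hfib, hfib]
  exact hineq ζ₀ hζ₀'.1 𝓔 h𝓔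

end BlocksOn

/-! ## The transport of the two counts -/

section Transport

variable {ends : E → Sym2 V} {e₀ : E} {l h o u : V} {U : Set V}

/-- The `Q`-class is empty unless `h ∈ U`. -/
lemma swOutSide_eq_empty_of_notMem (hh : h ∉ U) (ξ : Config E) :
    swOutSide ends l h o U ξ = ∅ := by
  ext ζ
  simp only [Finset.notMem_empty, iff_false]
  intro hζ
  exact hh ((mem_outClass.1 (mem_swOutSide.1 hζ).2).2 (Or.inl (mem_cluster_self _ _ _)))

/-- `l` is not in the red cluster of `h` on the `Q`-class. -/
lemma l_notMem_cluster_of_mem_swOutSide {ξ ζ : Config E} (hζ : ζ ∈ swOutSide ends l h o U ξ) :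
    l ∉ cluster ends ζ h :=
  fun hl' => l_notMem_hull_of_mem_tgtU (mem_swOutSide.1 hζ).1 (Or.inl hl')

/-- `l` is not in the blue cluster of `h` on the `Q`-class. -/
lemma l_notMem_cluster_blue_of_mem_swOutSide {ξ ζ : Config E}
    (hζ : ζ ∈ swOutSide ends l h o U ξ) : l ∉ cluster ends (blue ζ) h :=
  fun hl' => l_notMem_hull_of_mem_tgtU (mem_swOutSide.1 hζ).1 (Or.inr hl')

/-- **The uniform `Q`-class of `G⁺` is the image of the `Q`-class of `G` under the uniform lift**,
with the red edge sets pushed along. -/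
lemma filter_uniform_red_eq_image (he₀ : ends e₀ = s(h, u)) (hl : l ∉ U) (hh : h ∈ U)
    (ξ : Config E) (𝓔 : Set (Set E)) :
    ((swOutSide (subdEnds ends e₀ h u l) (some l) (some h) (some o) (subdRegion U)
        (ulift e₀ ξ)).filter fun ζ' => Uniform e₀ ζ' ∧
          redEdges (subdEnds ends e₀ h u l) ζ' (some h) ∈ {F | subdPull e₀ F ∈ 𝓔}) =
      ((swOutSide ends l h o U ξ).filter fun ζ => redEdges ends ζ h ∈ 𝓔).image (ulift e₀) := by
  ext ζ'
  simp only [Finset.mem_filter, Finset.mem_image, Set.mem_setOf_eq]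
  constructor
  · rintro ⟨hζ', hun, hE⟩
    set ζ := ζ' ∘ Sum.inl with hζdef
    have heq : ζ' = ulift e₀ ζ := eq_ulift_of_uniform hl (mem_swOutSide.1 hζ').2 hun
    rw [heq] at hζ' hE
    have hζ : ζ ∈ swOutSide ends l h o U ξ := (mem_swOutSide_ulift_iff he₀ hh).1 hζ'
    refine ⟨ζ, ⟨hζ, ?_⟩, heq.symm⟩
    rwa [redEdges_ulift he₀ (l_notMem_cluster_of_mem_swOutSide hζ), subdPull_subdPush] at hE
  · rintro ⟨ζ, ⟨hζ, hE⟩, rfl⟩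
    refine ⟨(mem_swOutSide_ulift_iff he₀ hh).2 hζ, uniform_ulift ζ, ?_⟩
    rw [redEdges_ulift he₀ (l_notMem_cluster_of_mem_swOutSide hζ), subdPull_subdPush]
    exact hE

/-- The blue counterpart of `filter_uniform_red_eq_image`. -/
lemma filter_uniform_blue_eq_image (he₀ : ends e₀ = s(h, u)) (hl : l ∉ U) (hh : h ∈ U)
    (ξ : Config E) (𝓔 : Set (Set E)) :
    ((swOutSide (subdEnds ends e₀ h u l) (some l) (some h) (some o) (subdRegion U)
        (ulift e₀ ξ)).filter fun ζ' => Uniform e₀ ζ' ∧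
          blueEdges (subdEnds ends e₀ h u l) ζ' (some h) ∈ {F | subdPull e₀ F ∈ 𝓔}) =
      ((swOutSide ends l h o U ξ).filter fun ζ => blueEdges ends ζ h ∈ 𝓔).image (ulift e₀) := by
  ext ζ'
  simp only [Finset.mem_filter, Finset.mem_image, Set.mem_setOf_eq]
  constructor
  · rintro ⟨hζ', hun, hE⟩
    set ζ := ζ' ∘ Sum.inl with hζdef
    have heq : ζ' = ulift e₀ ζ := eq_ulift_of_uniform hl (mem_swOutSide.1 hζ').2 hun
    rw [heq] at hζ' hE
    have hζ : ζ ∈ swOutSide ends l h o U ξ := (mem_swOutSide_ulift_iff he₀ hh).1 hζ'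
    refine ⟨ζ, ⟨hζ, ?_⟩, heq.symm⟩
    rwa [blueEdges_ulift he₀ (l_notMem_cluster_blue_of_mem_swOutSide hζ), subdPull_subdPush] at hE
  · rintro ⟨ζ, ⟨hζ, hE⟩, rfl⟩
    refine ⟨(mem_swOutSide_ulift_iff he₀ hh).2 hζ, uniform_ulift ζ, ?_⟩
    rw [blueEdges_ulift he₀ (l_notMem_cluster_blue_of_mem_swOutSide hζ), subdPull_subdPush]
    exact hE

/-- **The red count transports** to the uniform part of the class of `G⁺`. -/
lemma card_red_eq (he₀ : ends e₀ = s(h, u)) (hl : l ∉ U) (hh : h ∈ U) (ξ : Config E)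
    (𝓔 : Set (Set E)) :
    ((swOutSide ends l h o U ξ).filter fun ζ => redEdges ends ζ h ∈ 𝓔).card =
      ((swOutSide (subdEnds ends e₀ h u l) (some l) (some h) (some o) (subdRegion U)
        (ulift e₀ ξ)).filter fun ζ' => Uniform e₀ ζ' ∧
          redEdges (subdEnds ends e₀ h u l) ζ' (some h) ∈ {F | subdPull e₀ F ∈ 𝓔}).card := by
  rw [filter_uniform_red_eq_image he₀ hl hh ξ 𝓔, Finset.card_image_of_injective _ ulift_injective]

/-- **The blue count transports** to the uniform part of the class of `G⁺`. -/
lemma card_blue_eq (he₀ : ends e₀ = s(h, u)) (hl : l ∉ U) (hh : h ∈ U) (ξ : Config E)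
    (𝓔 : Set (Set E)) :
    ((swOutSide ends l h o U ξ).filter fun ζ => blueEdges ends ζ h ∈ 𝓔).card =
      ((swOutSide (subdEnds ends e₀ h u l) (some l) (some h) (some o) (subdRegion U)
        (ulift e₀ ξ)).filter fun ζ' => Uniform e₀ ζ' ∧
          blueEdges (subdEnds ends e₀ h u l) ζ' (some h) ∈ {F | subdPull e₀ F ∈ 𝓔}).card := by
  rw [filter_uniform_blue_eq_image he₀ hl hh ξ 𝓔, Finset.card_image_of_injective _ ulift_injective]

end Transport

/-! ## Theorem A with the edge `h–u` -/

section Main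

variable {ends : E → Sym2 V} {e₀ : E} {l h o u : V} {U : Set V}

/-- **THEOREM A WITH THE EDGE `h–u`**: the rigid inequality on every class of a single-junction
region whose junction `u` is joined to `h` by exactly one edge `e₀` (no loop at `h` or `u`, every
other vertex of `U ∖ {h, o}` with an outside edge or no edge, the simple-arm hypothesis (H1)), for
every outside colouring `ξ`. -/
theorem rigidOK_of_junctionH1_edge (hl : l ∉ U) (hhu : h ≠ u) (hloop_h : ∀ e, ends e ≠ s(h, h))
    (hloop_u : ∀ e, ends e ≠ s(u, u)) (he₀ : ends e₀ = s(h, u))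
    (huniq : ∀ e, ends e = s(h, u) → e = e₀)
    (hout : ∀ x ∈ U, x ≠ h → x ≠ o → x ≠ u →
      (∃ e y, ends e = s(x, y) ∧ y ∉ U) ∨ (∀ e, x ∉ ends e))
    (hH1 : H1 ends U h u) (ξ : Config E) : RigidOK ends l h o U ξ := by
  intro 𝓔 h𝓔
  by_cases hh : h ∈ U
  swap
  · rw [swOutSide_eq_empty_of_notMem hh]
    simp
  have hl' : some l ∉ subdRegion U := subd_hl hl
  have hhu' : (some h : Option V) ≠ some u := subd_hhu hhu
  have hloop_h' : ∀ e, subdEnds ends e₀ h u l e ≠ s(some h, some h) := subd_loop_h hloop_h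
  have hloop_u' : ∀ e, subdEnds ends e₀ h u l e ≠ s(some u, some u) := subd_loop_u hloop_u
  have hnadj' : ∀ e, subdEnds ends e₀ h u l e ≠ s(some h, some u) := subd_nadj huniq
  have hout' : ∀ x ∈ subdRegion U, x ≠ some h → x ≠ some o → x ≠ some u →
      (∃ e y, subdEnds ends e₀ h u l e = s(x, y) ∧ y ∉ subdRegion U) ∨
        (∀ e, x ∉ subdEnds ends e₀ h u l e) := subd_hout hl he₀ hout
  have hH1' : H1 (subdEnds ends e₀ h u l) (subdRegion U) (some h) (some u) :=
    subd_H1 hl hhu hloop_u he₀ hH1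
  rw [card_red_eq he₀ hl hh ξ 𝓔, card_blue_eq he₀ hl hh ξ 𝓔]
  exact card_le_of_blocks_on (ulift e₀ ξ)
    (keyOf (subdEnds ends e₀ h u l) (subdRegion U) (ulift e₀ ξ) (some h) (some u))
    (blockOf (subdEnds ends e₀ h u l) (some h) (some u)) (Uniform e₀)
    (fun _ hζ => mem_blockOf_keyOf hl' hhu' hloop_h' hout' hζ)
    (fun _ hζ _ hζ' hQ =>
      keyOf_eq_of_mem_blockOf hl' hhu' hloop_h' hloop_u' hnadj' hout' hH1' hζ hζ' hQ)
    (fun _ hζ hun _ hζ' =>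
      uniform_of_mem_blockOf hl' hhu hloop_h' hloop_u' hnadj' hout' hH1' hζ hun hζ')
    (fun _ hζ _ h𝓔' => card_blockOf_le hl' hhu' hloop_h' hloop_u' hnadj' hout' hH1' hζ h𝓔')
    (isUpperSet_subdPull_preimage h𝓔)

/-- A region with one (H1) junction adjacent to `h` by a single edge is a base region of the series
reduction. -/
theorem reducible_of_junctionH1_edge (hl : l ∉ U) (hhu : h ≠ u) (hloop_h : ∀ e, ends e ≠ s(h, h))
    (hloop_u : ∀ e, ends e ≠ s(u, u)) (he₀ : ends e₀ = s(h, u))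
    (huniq : ∀ e, ends e = s(h, u) → e = e₀)
    (hout : ∀ x ∈ U, x ≠ h → x ≠ o → x ≠ u →
      (∃ e y, ends e = s(x, y) ∧ y ∉ U) ∨ (∀ e, x ∉ ends e))
    (hH1 : H1 ends U h u) : Reducible l h o ends U :=
  Reducible.base ends U fun ξ =>
    rigidOK_of_junctionH1_edge hl hhu hloop_h hloop_u he₀ huniq hout hH1 ξ

/-- **Row 2′SW-ALL on every graph with one (H1) junction adjacent to `h`**: every vertex other than
`l, h, o, u` is joined to `l`, `u ≠ l`, no loop at `h` or `u`, `e₀` the only edge `h–u`, and (H1) in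
`{l}ᶜ`. -/
theorem swAll_of_junctionH1_edge (hlh : l ≠ h) (hhu : h ≠ u) (hloop_h : ∀ e, ends e ≠ s(h, h))
    (hloop_u : ∀ e, ends e ≠ s(u, u)) (he₀ : ends e₀ = s(h, u))
    (huniq : ∀ e, ends e = s(h, u) → e = e₀) (hH1 : H1 ends ({l}ᶜ) h u)
    (hjoin : ∀ x, x ≠ l → x ≠ h → x ≠ o → x ≠ u → ∃ e, ends e = s(x, l)) : SwAll ends l h o := by
  refine swAll_of_reducible l h o hlh
    (reducible_of_junctionH1_edge (by simp) hhu hloop_h hloop_u he₀ huniq ?_ hH1)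
  intro x hx hxh hxo hxu
  obtain ⟨e, he⟩ := hjoin x (by simpa using hx) hxh hxo hxu
  exact Or.inl ⟨e, l, he, by simp⟩

/-- **Row (SW) on every graph with one (H1) junction adjacent to `h`** (see
`swAll_of_junctionH1_edge`). -/
theorem sw_of_junctionH1_edge (hlh : l ≠ h) (hhu : h ≠ u) (hloop_h : ∀ e, ends e ≠ s(h, h))
    (hloop_u : ∀ e, ends e ≠ s(u, u)) (he₀ : ends e₀ = s(h, u))
    (huniq : ∀ e, ends e = s(h, u) → e = e₀) (hH1 : H1 ends ({l}ᶜ) h u)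
    (hjoin : ∀ x, x ≠ l → x ≠ h → x ≠ o → x ≠ u → ∃ e, ends e = s(x, l)) : Sw ends l h o :=
  sw_of_swAll ends (swAll_of_junctionH1_edge hlh hhu hloop_h hloop_u he₀ huniq hH1 hjoin)

end Main

end LocRows

end Summit.Ventures.PercRepro2
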